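/-
Copyright (c) 2026 the pub-hodgecm-mathlib formalisation cell (harness21).  Prover seat hodgecm-mathlib-K2Liu-p27 (g0), Track B «K2-LIT»,
#184♮ = hLiu418 = `stmt-HodgeConjecture-24832`; #42S organ S2, (B) CONJUGACY of the archimedean compacts of standard Iwasawa data, file B2 (the arch transport)
(desk K2Liu-p05 (g6) 2026-09-04T15:34:14Z «(B) GO»; LEAD F0P6-plan (g14) BATCH #45∕#46).
-/
import Summits.HodgeConjecture.HodgeConjecture.Theorems.K2LiuMajorantStabiliserConjugate   -- ★ B1 `exists_conj_of_majorantFrames`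
import Literature.NumberTheory.K2Lit.SiegelStandardIwasawaData                             -- ★ `IwasawaDatum.IsStd`, `IsStd.exists_arch`
import Literature.NumberTheory.Automorphic.UnitaryGroupArchimedeanPlaces                    -- ★ `archPiEquivCM`, `mem_arch_iff_forall`, `archAt`
import Literature.NumberTheory.GelbartRogawski1991.UnitaryDualPairThetaKernelCM               -- ★ `complexConj_smul_infinitePlace`, CM place facts
import Literature.NumberTheory.GelbartRogawski1991.DoubledWeilRepresentationArchHalf          -- ★ `gramD_eq_diagonal_cm` (+ ★ `gramD_gram_realDiagonal_entry_ne_zero`)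
import Literature.NumberTheory.Automorphic.UnitaryGroupSymplecticCarriers                     -- ★ `ofReal_re_embedding_algebraMap`
import HarnessLib

/-!
# Crux `HLiu418`, #42S organ S2, (B) file B2: THE ARCHIMEDEAN COMPACT OF A STANDARD IWASAWA DATUM IS CONJUGATE, INSIDE `H(L⁺ ⊗ ℝ)`,
# TO THE STABILISER OF THE DIAGONAL MAJORANT (the sign-block-diagonal elements at every complex place)

Cell `hodgecm-mathlib`, crux item hLiu418 = `stmt-HodgeConjecture-24832`; squad K2 ∕ K2Liu; LEAD F0P6-plan (g14), co-dealer K2E5-plan (g7), S2 desk K2Liu-p05 (g6); prover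
K2Liu-p27 (g0).  THEOREMS ONLY (no `def`, no instance, no notation, no named-fact hypothesis, no `sorry`); lane `--supports stmt-HodgeConjecture-24832 --as helper`.

WHY (census K2Liu-p27 (g0) 2026-09-04T15:33:43Z; desk 15:34:14Z (B′) = (B) + transport wrapper).  Socket #42S quantifies `∀ (𝒦) (_ : 𝒦.IsStd)`; the S2 letters live in the
stabiliser `K_diag` of the DIAGONAL majorant `|J^𝔻|` (block-unitaries of the sign splitting at every complex place), while a standard datum's archimedean part
`C_∞ = {a | S⁻¹ a S ∈ U(1)(L ⊗ ℝ)}` (★ `IwasawaDatum.IsStd` (P2), frame `S` existential) is the stabiliser of SOME majorant — for the tree's `K₉` a different one.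
* §1 (generic index `m`, one complex place): for a real non-degenerate DIAGONAL form `H = diag(d)` and a majorant frame `S` (`(Sᴴ H S)² = 1`) there is `g ∈ U(H)` with
  `S⁻¹ a S ∈ U(m) ↔ (g⁻¹ a g) i j = 0 whenever d_i d_j < 0`, for every `a ∈ U(H)` (`exists_conj_stab_iff_signBlock`; ★ B1 with the diagonal frame `|d|^{-1∕2}`, then
  `Stab(|H|) ∩ U(H) = {x | x E = E x}`, `E = diag(sign d)`).
* §2 (the CM datum): **`exists_conj_archCompact`** — for `𝒦.IsStd` there is `g ∈ H(L⁺ ⊗ ℝ)` such that for every archimedean `a`: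
  `archToAdelic a ∈ 𝒦.K ↔` every complex-place component of `g⁻¹ a g` is sign-block-diagonal for the signs of the (real) diagonal entries of `σ_w(J^𝔻)`.
The wrapper `K2LiuArchSWSpanningConjTransport` (K2Liu-p23) translates sections by `g`; the bridge from «sign-block-diagonal at every place» to σ15's
`Submonoid.closure {placeSec σ (kV k₁)}` ∕ `archUFormPi … ∈ (kV).range` is the frame files' reading (`coe_archUForm` = `reindex ε (scaleConj D ·)`).
References: [Weil1964] Chap. I n° 8; [BorelJacquet1979] §4.1; [PlatonovRapinchuk1994] §3.2; [Tan1999] §1 p. 166.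
HONEST LABEL.  Count-neutral helper: `HC_CM` is proved only modulo the 7 printed citations (2 remaining named inputs: hLiu418 = `stmt-HodgeConjecture-24832`,
h413 = `stmt-HodgeConjecture-24833`) until rung 0 closes; this file closes no socket.
-/

set_option autoImplicit false
set_option linter.dupNamespace false -- the mandated namespace repeats `HodgeConjecture.HodgeConjecture`

noncomputable section

open scoped Matrix ComplexConjugate
open NumberField NumberField.InfinitePlace NumberField.mixedEmbedding
open Summit.HodgeConjecture.HodgeConjecture.Cruxes.HLiu418.K2LiuMajorantStabiliserConjugate

namespace Summit.HodgeConjecture.HodgeConjecture.Cruxes.HLiu418.K2LiuStdArchCompactConjugate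

/-! ## §1 One complex place: the stabiliser of the diagonal majorant is the sign-block-diagonal subgroup of `U(diag d)` -/

section SignFrame

variable {m : Type*} [Fintype m] [DecidableEq m]

/-- for non-zero reals, `a∕|a| ≠ b∕|b|` iff `a b < 0`. [folklore] -/
theorem div_abs_ne_iff_mul_neg {a b : ℝ} (ha : a ≠ 0) (hb : b ≠ 0) : a / |a| ≠ b / |b| ↔ a * b < 0 := by
  rcases lt_or_lt_iff_ne.2 ha with ha' | ha' <;> rcases lt_or_lt_iff_ne.2 hb with hb' | hb'
  · rw [abs_of_neg ha', abs_of_neg hb', div_neg, div_neg, div_self ha, div_self hb]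
    exact ⟨fun h => absurd rfl h, fun h => absurd h (not_lt.2 (mul_pos_of_neg_of_neg ha' hb').le)⟩
  · rw [abs_of_neg ha', abs_of_pos hb', div_neg, div_self ha, div_self hb]
    exact ⟨fun _ => mul_neg_of_neg_of_pos ha' hb', fun _ => by norm_num⟩
  · rw [abs_of_pos ha', abs_of_neg hb', div_neg, div_self ha, div_self hb]
    exact ⟨fun _ => mul_neg_of_pos_of_neg ha' hb', fun _ => by norm_num⟩
  · rw [abs_of_pos ha', abs_of_pos hb', div_self ha, div_self hb]
    exact ⟨fun h => absurd rfl h, fun h => absurd h (not_lt.2 (mul_pos ha' hb').le)⟩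

/-- `x` commutes with a diagonal matrix `diag s` iff `x i j = 0` whenever `s i ≠ s j`. [folklore] -/
theorem mul_diagonal_eq_diagonal_mul_iff (s : m → ℂ) (x : Matrix m m ℂ) :
    x * Matrix.diagonal s = Matrix.diagonal s * x ↔ ∀ i j, s i ≠ s j → x i j = 0 := by
  constructor
  · intro h i j hij
    have hx : x i j * s j = s i * x i j := by
      have := congrFun (congrFun h i) j
      rwa [Matrix.mul_diagonal, Matrix.diagonal_mul] at this
    have h2 : (s j - s i) * x i j = 0 := by rw [sub_mul, mul_comm (s j), hx, sub_self]
    exact (mul_eq_zero.1 h2).resolve_left (sub_ne_zero.2 (Ne.symm hij))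
  · intro h
    ext i j
    rw [Matrix.mul_diagonal, Matrix.diagonal_mul]
    by_cases hij : s i = s j
    · rw [hij, mul_comm]
    · rw [h i j hij, mul_zero, zero_mul]

/-- an element of `U(H)` for an invertible `H` is invertible. [folklore] -/
theorem isUnit_of_conjTranspose_mul_mul_eq {H x : Matrix m m ℂ} (hH : IsUnit H) (hx : xᴴ * H * x = H) : IsUnit x := by
  rw [Matrix.isUnit_iff_isUnit_det] at hH ⊢
  have h := congrArg Matrix.det hx
  rw [Matrix.det_mul, Matrix.det_mul] at h
  exact isUnit_of_mul_isUnit_right (by rw [h]; exact hH)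

/-- **the diagonal-majorant stabiliser inside `U(diag d)`**: for `x ∈ U(diag d)` (`d` real non-zero), `xᴴ diag|d| x = diag|d|` iff `x` commutes with `E = diag(d∕|d|)`.
[cite: Weil1964, Chap. I n° 8] -/
theorem conjTranspose_mul_abs_mul_eq_iff_commute (d : m → ℝ) (hd : ∀ j, d j ≠ 0) {x : Matrix m m ℂ}
    (hx : xᴴ * Matrix.diagonal (fun j => (d j : ℂ)) * x = Matrix.diagonal (fun j => (d j : ℂ))) :
    xᴴ * Matrix.diagonal (fun j => ((|d j| : ℝ) : ℂ)) * x = Matrix.diagonal (fun j => ((|d j| : ℝ) : ℂ)) ↔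
      x * Matrix.diagonal (fun j => ((d j / |d j| : ℝ) : ℂ)) = Matrix.diagonal (fun j => ((d j / |d j| : ℝ) : ℂ)) * x := by
  -- `A = H E = E H`
  have hHE : Matrix.diagonal (fun j => (d j : ℂ)) * Matrix.diagonal (fun j => ((d j / |d j| : ℝ) : ℂ)) =
      Matrix.diagonal (fun j => ((|d j| : ℝ) : ℂ)) := by
    rw [Matrix.diagonal_mul_diagonal]
    refine congrArg Matrix.diagonal (funext fun j => ?_)
    have hj : (|d j| : ℝ) ≠ 0 := abs_ne_zero.2 (hd j)
    rw [← Complex.ofReal_mul]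
    refine congrArg _ ?_
    rw [mul_div_assoc', div_eq_iff hj, abs_mul_abs_self]
  have hHu : IsUnit (Matrix.diagonal (fun j => (d j : ℂ))) := by
    rw [Matrix.isUnit_iff_isUnit_det, Matrix.det_diagonal]
    exact IsUnit.mk0 _ (Finset.prod_ne_zero_iff.2 fun j _ => Complex.ofReal_ne_zero.2 (hd j))
  have hxu : IsUnit x := isUnit_of_conjTranspose_mul_mul_eq hHu hx
  have hxHu : IsUnit (xᴴ * Matrix.diagonal (fun j => (d j : ℂ))) := (isUnit_conjTranspose hxu).mul hHu
  constructor
  · intro hA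
    -- `xᴴ H x E = H E = A = xᴴ A x = xᴴ H E x`; cancel `xᴴ H`
    have h1 : xᴴ * Matrix.diagonal (fun j => (d j : ℂ)) * (x * Matrix.diagonal (fun j => ((d j / |d j| : ℝ) : ℂ))) =
        xᴴ * Matrix.diagonal (fun j => (d j : ℂ)) * (Matrix.diagonal (fun j => ((d j / |d j| : ℝ) : ℂ)) * x) := by
      calc xᴴ * Matrix.diagonal (fun j => (d j : ℂ)) * (x * Matrix.diagonal (fun j => ((d j / |d j| : ℝ) : ℂ)))
          = (xᴴ * Matrix.diagonal (fun j => (d j : ℂ)) * x) * Matrix.diagonal (fun j => ((d j / |d j| : ℝ) : ℂ)) := by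
            simp only [Matrix.mul_assoc]
        _ = Matrix.diagonal (fun j => ((|d j| : ℝ) : ℂ)) := by rw [hx, hHE]
        _ = xᴴ * Matrix.diagonal (fun j => ((|d j| : ℝ) : ℂ)) * x := hA.symm
        _ = xᴴ * Matrix.diagonal (fun j => (d j : ℂ)) * (Matrix.diagonal (fun j => ((d j / |d j| : ℝ) : ℂ)) * x) := by
            rw [← hHE]; simp only [Matrix.mul_assoc]
    obtain ⟨u, hu⟩ := hxHu
    have h2 := congrArg (fun y => (↑u⁻¹ : Matrix m m ℂ) * y) h1
    simp only [← hu, ← Matrix.mul_assoc, Units.inv_mul, Matrix.one_mul] at h2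
    exact h2
  · intro hE
    calc xᴴ * Matrix.diagonal (fun j => ((|d j| : ℝ) : ℂ)) * x
        = xᴴ * (Matrix.diagonal (fun j => (d j : ℂ)) * (Matrix.diagonal (fun j => ((d j / |d j| : ℝ) : ℂ)) * x)) := by
          rw [← hHE]; simp only [Matrix.mul_assoc]
      _ = xᴴ * Matrix.diagonal (fun j => (d j : ℂ)) * x * Matrix.diagonal (fun j => ((d j / |d j| : ℝ) : ℂ)) := by
          rw [← hE]; simp only [Matrix.mul_assoc]
      _ = Matrix.diagonal (fun j => ((|d j| : ℝ) : ℂ)) := by rw [hx, hHE]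

/-- **conjugation by the diagonal frame**: with `S₂ = diag((√|d|)⁻¹)`, `S₂⁻¹ x S₂ ∈ U(m) ↔ xᴴ diag|d| x = diag|d|`. [cite: Weil1964, Chap. I n° 8] -/
theorem diagFrame_conj_mem_unitaryGroup_iff (d : m → ℝ) (hd : ∀ j, d j ≠ 0) (x : Matrix m m ℂ) :
    (Matrix.diagonal (fun j => (((Real.sqrt |d j|)⁻¹ : ℝ) : ℂ)))⁻¹ * x * Matrix.diagonal (fun j => (((Real.sqrt |d j|)⁻¹ : ℝ) : ℂ)) ∈
        Matrix.unitaryGroup m ℂ ↔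
      xᴴ * Matrix.diagonal (fun j => ((|d j| : ℝ) : ℂ)) * x = Matrix.diagonal (fun j => ((|d j| : ℝ) : ℂ)) := by
  have hsq : ∀ j, 0 < Real.sqrt |d j| := fun j => Real.sqrt_pos.2 (abs_pos.2 (hd j))
  set T : Matrix m m ℂ := Matrix.diagonal (fun j => (((Real.sqrt |d j|)⁻¹ : ℝ) : ℂ)) with hT
  set R : Matrix m m ℂ := Matrix.diagonal (fun j => ((Real.sqrt |d j| : ℝ) : ℂ)) with hR
  have hRT : R * T = 1 := by
    rw [hR, hT, Matrix.diagonal_mul_diagonal, ← Matrix.diagonal_one]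
    refine congrArg Matrix.diagonal (funext fun j => ?_)
    rw [← Complex.ofReal_mul, mul_inv_cancel₀ (hsq j).ne', Complex.ofReal_one]
  have hTR : T * R = 1 := mul_eq_one_comm.1 hRT
  have hTinv : T⁻¹ = R := Matrix.inv_eq_left_inv hRT
  have hRherm : Rᴴ = R := by
    rw [hR, Matrix.diagonal_conjTranspose]
    exact congrArg Matrix.diagonal (funext fun j => Complex.conj_ofReal _)
  have hTherm : Tᴴ = T := by
    rw [hT, Matrix.diagonal_conjTranspose]
    exact congrArg Matrix.diagonal (funext fun j => Complex.conj_ofReal _)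
  have hRR : R * R = Matrix.diagonal (fun j => ((|d j| : ℝ) : ℂ)) := by
    rw [hR, Matrix.diagonal_mul_diagonal]
    refine congrArg Matrix.diagonal (funext fun j => ?_)
    rw [← Complex.ofReal_mul, Real.mul_self_sqrt (abs_nonneg _)]
  rw [hTinv, Matrix.mem_unitaryGroup_iff', Matrix.star_eq_conjTranspose, Matrix.conjTranspose_mul, Matrix.conjTranspose_mul, hRherm, hTherm]
  -- `T xᴴ R (R x T) = 1 ↔ xᴴ (R R) x = R R`
  constructor
  · intro h
    have h' : R * (T * (xᴴ * R) * (R * x * T)) * R = R * 1 * R := by rw [h]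
    rw [Matrix.mul_one] at h'
    calc xᴴ * Matrix.diagonal (fun j => ((|d j| : ℝ) : ℂ)) * x = (R * T) * xᴴ * (R * R) * x * (T * R) := by
          rw [hRT, hTR, Matrix.one_mul, Matrix.mul_one, hRR]
      _ = R * (T * (xᴴ * R) * (R * x * T)) * R := by simp only [Matrix.mul_assoc]
      _ = Matrix.diagonal (fun j => ((|d j| : ℝ) : ℂ)) := by rw [h', hRR]
  · intro h
    calc T * (xᴴ * R) * (R * x * T) = T * (xᴴ * (R * R) * x) * T := by simp only [Matrix.mul_assoc]
      _ = T * (R * R) * T := by rw [hRR, h]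
      _ = 1 := by rw [← Matrix.mul_assoc T R R, hTR, Matrix.one_mul, hRT]

/-- **ONE COMPLEX PLACE: the majorant stabiliser of a standard frame is `U(H)`-conjugate to the sign-block-diagonal subgroup.**  For `H = diag(d)` (`d` real, non-zero)
and a frame `S` with `(Sᴴ H S)² = 1` there is `g ∈ U(H)` (invertible, `gᴴ H g = H`) such that for every `a ∈ U(H)`:
`S⁻¹ a S ∈ U(m) ↔ (g⁻¹ a g) i j = 0` whenever `d_i d_j < 0`. [cite: Weil1964, Chap. I n° 8] [cite: PlatonovRapinchuk1994, §3.2] -/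
theorem exists_conj_stab_iff_signBlock (d : m → ℝ) (hd : ∀ j, d j ≠ 0) {S : Matrix m m ℂ} (hS : IsUnit S)
    (hmaj : Sᴴ * Matrix.diagonal (fun j => (d j : ℂ)) * S * (Sᴴ * Matrix.diagonal (fun j => (d j : ℂ)) * S) = 1) :
    ∃ g : Matrix m m ℂ, gᴴ * Matrix.diagonal (fun j => (d j : ℂ)) * g = Matrix.diagonal (fun j => (d j : ℂ)) ∧ IsUnit g ∧
      ∀ a : Matrix m m ℂ, aᴴ * Matrix.diagonal (fun j => (d j : ℂ)) * a = Matrix.diagonal (fun j => (d j : ℂ)) →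
        (S⁻¹ * a * S ∈ Matrix.unitaryGroup m ℂ ↔ ∀ i j, d i * d j < 0 → (g⁻¹ * a * g) i j = 0) := by
  set H : Matrix m m ℂ := Matrix.diagonal (fun j => (d j : ℂ)) with hHdef
  set T : Matrix m m ℂ := Matrix.diagonal (fun j => (((Real.sqrt |d j|)⁻¹ : ℝ) : ℂ)) with hT
  have hsq : ∀ j, 0 < Real.sqrt |d j| := fun j => Real.sqrt_pos.2 (abs_pos.2 (hd j))
  have hHherm : Hᴴ = H := by
    rw [hHdef, Matrix.diagonal_conjTranspose]
    exact congrArg Matrix.diagonal (funext fun j => Complex.conj_ofReal _)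
  have hTherm : Tᴴ = T := by
    rw [hT, Matrix.diagonal_conjTranspose]
    exact congrArg Matrix.diagonal (funext fun j => Complex.conj_ofReal _)
  have hTu : IsUnit T := by
    rw [Matrix.isUnit_iff_isUnit_det, hT, Matrix.det_diagonal]
    exact IsUnit.mk0 _ (Finset.prod_ne_zero_iff.2 fun j _ => Complex.ofReal_ne_zero.2 (inv_ne_zero (hsq j).ne'))
  -- the diagonal frame is a majorant frame: `Tᴴ H T = diag(d∕|d|)`, an involution
  have hTHT : Tᴴ * H * T = Matrix.diagonal (fun j => ((d j / |d j| : ℝ) : ℂ)) := by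
    rw [hTherm, hT, hHdef, Matrix.diagonal_mul_diagonal, Matrix.diagonal_mul_diagonal]
    refine congrArg Matrix.diagonal (funext fun j => ?_)
    rw [← Complex.ofReal_mul, ← Complex.ofReal_mul]
    refine congrArg _ ?_
    rw [mul_comm ((Real.sqrt |d j|)⁻¹) (d j), mul_assoc, ← mul_inv, Real.mul_self_sqrt (abs_nonneg _), div_eq_mul_inv]
  have hTmaj : Tᴴ * H * T * (Tᴴ * H * T) = 1 := by
    rw [hTHT, Matrix.diagonal_mul_diagonal, ← Matrix.diagonal_one]
    refine congrArg Matrix.diagonal (funext fun j => ?_)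
    rw [← Complex.ofReal_mul, ← Complex.ofReal_one]
    refine congrArg _ ?_
    have hj : (|d j| : ℝ) ≠ 0 := abs_ne_zero.2 (hd j)
    rw [div_mul_div_comm, ← sq, ← sq, sq_abs, div_self (pow_ne_zero 2 (hd j))]
  obtain ⟨g, hgH, hgu, hiff⟩ := exists_conj_of_majorantFrames hHherm hS hTu hmaj hTmaj
  refine ⟨g, hgH, hgu, fun a ha => ?_⟩
  rw [hiff a]
  -- `x := g⁻¹ a g ∈ U(H)`
  have hgdet : IsUnit g.det := (Matrix.isUnit_iff_isUnit_det g).1 hgu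
  have hginvH : (g⁻¹)ᴴ * H * g⁻¹ = H := by
    calc (g⁻¹)ᴴ * H * g⁻¹ = (g⁻¹)ᴴ * (gᴴ * H * g) * g⁻¹ := by rw [hgH]
      _ = (g * g⁻¹)ᴴ * H * (g * g⁻¹) := by rw [Matrix.conjTranspose_mul]; simp only [Matrix.mul_assoc]
      _ = H := by rw [Matrix.mul_nonsing_inv g hgdet, Matrix.conjTranspose_one, Matrix.one_mul, Matrix.mul_one]
  have hx : (g⁻¹ * a * g)ᴴ * H * (g⁻¹ * a * g) = H := by
    rw [Matrix.conjTranspose_mul, Matrix.conjTranspose_mul]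
    calc gᴴ * (aᴴ * g⁻¹ᴴ) * H * (g⁻¹ * a * g) = gᴴ * (aᴴ * (g⁻¹ᴴ * H * g⁻¹) * a) * g := by simp only [Matrix.mul_assoc]
      _ = H := by rw [hginvH, ha, hgH]
  rw [diagFrame_conj_mem_unitaryGroup_iff d hd, conjTranspose_mul_abs_mul_eq_iff_commute d hd hx,
    mul_diagonal_eq_diagonal_mul_iff]
  refine forall_congr' fun i => forall_congr' fun j => ?_
  rw [Ne, Complex.ofReal_inj, ← Ne, div_abs_ne_iff_mul_neg (hd i) (hd j)]

end SignFrame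

/-! ## §2 The CM datum: the archimedean compact of a standard Iwasawa datum is conjugate to the sign-block-diagonal compact -/

section CM

open Literature.NumberTheory.Automorphic Literature.NumberTheory.Automorphic.UnitaryGroup
open Literature.NumberTheory.GelbartRogawski1991 Literature.NumberTheory.GelbartRogawski1991.GRConstruction
open Literature.NumberTheory.GelbartRogawski1991.UnitaryDualPair
open Literature.NumberTheory.K2Lit.SiegelDoubled

variable (L : Type) [Field L] [NumberField L] [IsCMField L]
variable {N M n : ℕ} (e : Fin N × Fin M ≃ Fin n)
  (dV : Fin N → L) (hdV : ∀ i, IsCMField.complexConj L (dV i) = dV i) (hdV0 : ∀ i, dV i ≠ 0)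
  (dW : Fin M → L) (hdW : ∀ i, IsCMField.complexConj L (dW i) = dW i) (hdW0 : ∀ i, dW i ≠ 0)

/-- transport of a matrix identity over `L ⊗ ℝ` to the complex place `w`: `(M.map conjMixed)ᵀ.map evalC_w = (M.map evalC_w)ᴴ`. [cite: BorelJacquet1979, §4.1] -/
theorem map_evalC_transpose_map_conjMixed (w : {w : InfinitePlace L // w.IsComplex}) (M : Matrix (Fin (n + n)) (Fin (n + n)) (mixedSpace L)) :
    ((M.map (UnitaryGroup.conjMixed (Fp L) L (IsCMField.complexConj L)))ᵀ).map (evalC L w) = (M.map (evalC L w))ᴴ := by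
  ext i j
  simp only [Matrix.map_apply, Matrix.transpose_apply, Matrix.conjTranspose_apply]
  rw [UnitaryGroup.evalC_conjMixed (Fp L) L (IsCMField.complexConj L) (complexConj_smul_infinitePlace L w.1) (IsCMField.complexConj_ne_one L)]
  rfl

include hdV0 hdW0 in
/-- **THE ARCHIMEDEAN COMPACT OF A STANDARD IWASAWA DATUM IS `H(L⁺ ⊗ ℝ)`-CONJUGATE TO THE SIGN-BLOCK-DIAGONAL COMPACT.**  For `𝒦.IsStd` there is
`g ∈ H(L⁺ ⊗ ℝ)` such that for every archimedean `a`: `(a, 1_f) ∈ 𝒦.K` iff at every complex place `w` the component `(g⁻¹ a g)_w` has `(i, j)` entry `0` whenever the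
real diagonal entries `σ_w(J^𝔻_{ii})`, `σ_w(J^𝔻_{jj})` have opposite signs — i.e. `g⁻¹ C_∞ g = Stab(|J^𝔻|) = K_diag`, the maximal compact in which the S2 letters live
(★ B1 + §1 at every complex place, glued by ★ `archPiEquivCM`; ★ `IsStd.exists_arch`, ★ `mem_arch_iff_forall`). [cite: Weil1964, Chap. I n° 8] [cite: BorelJacquet1979, §4.1]
[cite: PlatonovRapinchuk1994, §3.2] [cite: Tan1999, §1 p. 166] -/
theorem exists_conj_archCompact {𝒦 : IwasawaDatum L e dV hdV dW hdW} (h𝒦 : 𝒦.IsStd) :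
    ∃ g : UnitaryGroup.arch (Fp L) L (IsCMField.complexConj L) (n + n) (hermD L e dV hdV dW hdW),
      ∀ a : UnitaryGroup.arch (Fp L) L (IsCMField.complexConj L) (n + n) (hermD L e dV hdV dW hdW),
        (UnitaryGroup.archToAdelic (Fp L) L (IsCMField.complexConj L) (n + n) (hermD L e dV hdV dW hdW) a : HA L e dV hdV dW hdW) ∈ 𝒦.K ↔
          ∀ (w : {w : InfinitePlace L // w.IsComplex}) (i j : Fin (n + n)),
            (w.1.embedding (hermD L e dV hdV dW hdW i i)).re * (w.1.embedding (hermD L e dV hdV dW hdW j j)).re < 0 →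
            (((UnitaryGroup.archPiEquivCM (n + n) L (hermD L e dV hdV dW hdW) (g⁻¹ * a * g) w :
                UnitaryGroup.archLocal L (n + n) (hermD L e dV hdV dW hdW) w) : GL (Fin (n + n)) ℂ) : Matrix (Fin (n + n)) (Fin (n + n)) ℂ) i j = 0 := by
  classical
  have hc : IsCMField.complexConj L ≠ 1 := IsCMField.complexConj_ne_one L
  have hfix : ∀ w : InfinitePlace L, IsCMField.complexConj L • w = w := complexConj_smul_infinitePlace L
  obtain ⟨Cinf, S, hmaj, harch, hCK, hKC⟩ := h𝒦.exists_arch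
  -- the diagonal form and its real entries at the complex places
  have ht0 := gramD_gram_realDiagonal_entry_ne_zero L e dV hdV dW hdW hdV0 hdW0
  have hHd : hermD L e dV hdV dW hdW = (Matrix.diagonal fun k => Sum.elim (cmGramEntry L e dV hdV dW hdW) (-cmGramEntry L e dV hdV dW hdW)
      ((LocalSplitting.e₂ n).symm k)).map (algebraMap (Fp L) L) := by
    show (gramD L e dV hdV dW hdW).map _ = _
    rw [gramD_eq_diagonal_cm]
  have hHii : ∀ i, hermD L e dV hdV dW hdW i i = algebraMap (Fp L) L (Sum.elim (cmGramEntry L e dV hdV dW hdW) (-cmGramEntry L e dV hdV dW hdW)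
      ((LocalSplitting.e₂ n).symm i)) := fun i => by
    rw [hHd, Matrix.map_apply, Matrix.diagonal_apply_eq]
  -- `d w k = re σ_w (t₀ k)`, real and non-zero
  have hdC : ∀ (w : {w : InfinitePlace L // w.IsComplex}) (k : Fin (n + n)),
      (((w.1.embedding (hermD L e dV hdV dW hdW k k)).re : ℝ) : ℂ) = w.1.embedding (hermD L e dV hdV dW hdW k k) := fun w k => by
    rw [hHii]
    exact UnitaryGroup.ofReal_re_embedding_algebraMap (Fp L) L (IsCMField.complexConj L) w (hfix w.1) hc _
  have hd0 : ∀ (w : {w : InfinitePlace L // w.IsComplex}) (k : Fin (n + n)), (w.1.embedding (hermD L e dV hdV dW hdW k k)).re ≠ 0 := by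
    intro w k h0
    have h1 : w.1.embedding (hermD L e dV hdV dW hdW k k) = 0 := by rw [← hdC, h0, Complex.ofReal_zero]
    rw [hHii, map_eq_zero_iff _ (w.1.embedding).injective, map_eq_zero_iff _ (algebraMap (Fp L) L).injective] at h1
    exact ht0 k h1
  have hHw : ∀ w : {w : InfinitePlace L // w.IsComplex},
      (hermD L e dV hdV dW hdW).map w.1.embedding = Matrix.diagonal fun k => (((w.1.embedding (hermD L e dV hdV dW hdW k k)).re : ℝ) : ℂ) := by
    intro w
    conv_lhs => rw [hHd]
    rw [Matrix.map_map, Matrix.diagonal_map (by simp only [Function.comp_apply, map_zero])]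
    refine congrArg Matrix.diagonal (funext fun k => ?_)
    rw [hdC, hHii]
    rfl
  -- per-place frames and their majorant identities
  have hmajw : ∀ w : {w : InfinitePlace L // w.IsComplex},
      ((S : Matrix (Fin (n + n)) (Fin (n + n)) (mixedSpace L)).map (evalC L w))ᴴ *
            Matrix.diagonal (fun k => (((w.1.embedding (hermD L e dV hdV dW hdW k k)).re : ℝ) : ℂ)) *
          (S : Matrix (Fin (n + n)) (Fin (n + n)) (mixedSpace L)).map (evalC L w) *
        (((S : Matrix (Fin (n + n)) (Fin (n + n)) (mixedSpace L)).map (evalC L w))ᴴ *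
            Matrix.diagonal (fun k => (((w.1.embedding (hermD L e dV hdV dW hdW k k)).re : ℝ) : ℂ)) *
          (S : Matrix (Fin (n + n)) (Fin (n + n)) (mixedSpace L)).map (evalC L w)) = 1 := by
    intro w
    have h := congrArg (fun A : Matrix (Fin (n + n)) (Fin (n + n)) (mixedSpace L) => A.map (evalC L w)) hmaj
    simp only [Matrix.map_mul, map_evalC_transpose_map_conjMixed, UnitaryGroup.archFormOf_map_evalC, hHw,
      Matrix.map_one (evalC L w) (map_zero _) (map_one _)] at h
    exact h
  have hSw : ∀ w : {w : InfinitePlace L // w.IsComplex}, IsUnit ((S : Matrix (Fin (n + n)) (Fin (n + n)) (mixedSpace L)).map (evalC L w)) :=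
    fun w => ⟨(Matrix.GeneralLinearGroup.map (evalC L w) S), rfl⟩
  -- §1 at every place
  choose g hgH hgu hiff using fun w : {w : InfinitePlace L // w.IsComplex} =>
    exists_conj_stab_iff_signBlock (fun k => (w.1.embedding (hermD L e dV hdV dW hdW k k)).re) (hd0 w) (hSw w) (hmajw w)
  -- glue the `g w` into an element of `H(L⁺ ⊗ ℝ)`
  have hgmem : ∀ w : {w : InfinitePlace L // w.IsComplex},
      ((hgu w).unit : GL (Fin (n + n)) ℂ) ∈ UnitaryGroup.archLocal L (n + n) (hermD L e dV hdV dW hdW) w := by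
    intro w
    rw [UnitaryGroup.mem_archLocal_iff, hHw, IsUnit.unit_spec]
    exact hgH w
  let G : UnitaryGroup.arch (Fp L) L (IsCMField.complexConj L) (n + n) (hermD L e dV hdV dW hdW) :=
    (UnitaryGroup.archPiEquivCM (n + n) L (hermD L e dV hdV dW hdW)).symm fun w => ⟨(hgu w).unit, hgmem w⟩
  have hGw : ∀ w : {w : InfinitePlace L // w.IsComplex},
      UnitaryGroup.archPiEquivCM (n + n) L (hermD L e dV hdV dW hdW) G w = ⟨(hgu w).unit, hgmem w⟩ := fun w => by
    show UnitaryGroup.archPiEquivCM (n + n) L (hermD L e dV hdV dW hdW)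
      ((UnitaryGroup.archPiEquivCM (n + n) L (hermD L e dV hdV dW hdW)).symm fun w => ⟨(hgu w).unit, hgmem w⟩) w = _
    rw [ContinuousMulEquiv.apply_symm_apply]
  refine ⟨G, fun a => ?_⟩
  -- the component matrices of `a` at the complex places
  have haw : ∀ w : {w : InfinitePlace L // w.IsComplex},
      ((((a : UnitaryGroup.arch (Fp L) L (IsCMField.complexConj L) (n + n) (hermD L e dV hdV dW hdW)) : GL (Fin (n + n)) (mixedSpace L)) :
          Matrix (Fin (n + n)) (Fin (n + n)) (mixedSpace L)).map (evalC L w))ᴴ *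
        Matrix.diagonal (fun k => (((w.1.embedding (hermD L e dV hdV dW hdW k k)).re : ℝ) : ℂ)) *
        (((a : UnitaryGroup.arch (Fp L) L (IsCMField.complexConj L) (n + n) (hermD L e dV hdV dW hdW)) : GL (Fin (n + n)) (mixedSpace L)) :
          Matrix (Fin (n + n)) (Fin (n + n)) (mixedSpace L)).map (evalC L w) =
        Matrix.diagonal (fun k => (((w.1.embedding (hermD L e dV hdV dW hdW k k)).re : ℝ) : ℂ)) := by
    intro w
    have h := (UnitaryGroup.mem_arch_iff_forall (Fp L) L (IsCMField.complexConj L) (n + n) (hermD L e dV hdV dW hdW) hc hfix _).1 a.2 w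
    rw [UnitaryGroup.mem_archLocal_iff, hHw] at h
    exact h
  -- step 1: `(a, 1_f) ∈ 𝒦.K ↔ a ∈ C_∞ ↔ S⁻¹ a S ∈ U(1)(L ⊗ ℝ) ↔ ∀ w, S_w⁻¹ a_w S_w ∈ U(n+n)`
  have h1 : (UnitaryGroup.archToAdelic (Fp L) L (IsCMField.complexConj L) (n + n) (hermD L e dV hdV dW hdW) a : HA L e dV hdV dW hdW) ∈ 𝒦.K ↔ a ∈ Cinf := by
    constructor
    · intro h
      have h' := hKC _ h
      rwa [UnitaryGroup.archPart_archToAdelic] at h'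
    · exact hCK a
  rw [h1, harch a, UnitaryGroup.mem_arch_iff_forall (Fp L) L (IsCMField.complexConj L) (n + n) (1 : Matrix (Fin (n + n)) (Fin (n + n)) L) hc hfix]
  refine forall_congr' fun w => ?_
  -- the place-`w` component of `S⁻¹ a S`
  have hcoe : ((Matrix.GeneralLinearGroup.map (evalC L w) (S⁻¹ * (a : GL (Fin (n + n)) (mixedSpace L)) * S) : GL (Fin (n + n)) ℂ) :
      Matrix (Fin (n + n)) (Fin (n + n)) ℂ) =
      ((S : Matrix (Fin (n + n)) (Fin (n + n)) (mixedSpace L)).map (evalC L w))⁻¹ *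
        (((a : UnitaryGroup.arch (Fp L) L (IsCMField.complexConj L) (n + n) (hermD L e dV hdV dW hdW)) : GL (Fin (n + n)) (mixedSpace L)) :
          Matrix (Fin (n + n)) (Fin (n + n)) (mixedSpace L)).map (evalC L w) *
        (S : Matrix (Fin (n + n)) (Fin (n + n)) (mixedSpace L)).map (evalC L w) := by
    rw [map_mul, map_mul, map_inv, Units.val_mul, Units.val_mul, Matrix.coe_units_inv]
    rfl
  have hmemU : Matrix.GeneralLinearGroup.map (evalC L w) (S⁻¹ * (a : GL (Fin (n + n)) (mixedSpace L)) * S) ∈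
        UnitaryGroup.archLocal L (n + n) (1 : Matrix (Fin (n + n)) (Fin (n + n)) L) w ↔
      ((S : Matrix (Fin (n + n)) (Fin (n + n)) (mixedSpace L)).map (evalC L w))⁻¹ *
          (((a : UnitaryGroup.arch (Fp L) L (IsCMField.complexConj L) (n + n) (hermD L e dV hdV dW hdW)) : GL (Fin (n + n)) (mixedSpace L)) :
            Matrix (Fin (n + n)) (Fin (n + n)) (mixedSpace L)).map (evalC L w) *
          (S : Matrix (Fin (n + n)) (Fin (n + n)) (mixedSpace L)).map (evalC L w) ∈ Matrix.unitaryGroup (Fin (n + n)) ℂ := by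
    rw [UnitaryGroup.mem_archLocal_iff, Matrix.map_one _ (map_zero _) (map_one _), Matrix.mul_one, hcoe, Matrix.mem_unitaryGroup_iff']
    rfl
  rw [hmemU, hiff w _ (haw w)]
  -- the place-`w` component of `G⁻¹ a G` is `(g w)⁻¹ a_w (g w)`
  have hcomp : (((UnitaryGroup.archPiEquivCM (n + n) L (hermD L e dV hdV dW hdW) (G⁻¹ * a * G) w :
      UnitaryGroup.archLocal L (n + n) (hermD L e dV hdV dW hdW) w) : GL (Fin (n + n)) ℂ) : Matrix (Fin (n + n)) (Fin (n + n)) ℂ) =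
      (g w)⁻¹ * (((a : UnitaryGroup.arch (Fp L) L (IsCMField.complexConj L) (n + n) (hermD L e dV hdV dW hdW)) : GL (Fin (n + n)) (mixedSpace L)) :
          Matrix (Fin (n + n)) (Fin (n + n)) (mixedSpace L)).map (evalC L w) * g w := by
    rw [map_mul, map_mul, map_inv, Pi.mul_apply, Pi.mul_apply, Pi.inv_apply, hGw, Subgroup.coe_mul, Subgroup.coe_mul, Subgroup.coe_inv,
      Units.val_mul, Units.val_mul, Matrix.coe_units_inv, IsUnit.unit_spec]
    rfl
  rw [hcomp]

end CM

end Summit.HodgeConjecture.HodgeConjecture.Cruxes.HLiu418.K2LiuStdArchCompactConjugate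

end
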